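import Summits.Ventures.HodgeRepro2.T5SmithNonsingular

/-!
# The Cartan decomposition of `GL_n` over the fraction field of a PID

Tier-5 kernel support (blind cell pub-hodge-repro2, seat p8, gen 11); continues
`T5SmithNonsingular` (the Smith normal form of a nonsingular integral matrix).

For `R` a principal ideal domain with fraction field `F` (the record's `𝒪_v ⊂ F_v` is the case
`R` = a discrete valuation ring) and `K := GL_n(R)` inside `GL_n(F)`, every `g ∈ GL_n(F)` is
`g = k₁ · diag(a) · k₂` with `k₁, k₂ ∈ K` and `a ∈ (F^×)^n` — the non-archimedean **Cartan
decomposition** `GL_n(F) = K · A · K` of the record, here without any choice of uniformiser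
(the diagonal entries are not normalised to powers of `ϖ`; that normalisation is not needed for
the double-coset condition of Gelfand's trick, which is the use made of it downstream).

* `exists_integer_matrix` — clearing denominators: `g = d⁻¹ • (g₀.map (algebraMap R F))`
  with `d ∈ R ∖ {0}`, `g₀ ∈ M_n(R)` (Mathlib's `IsLocalization.exist_integer_multiples`);
* `det_map_ne_zero_of_det_ne_zero` — the integral matrix is again nonsingular;
* `coe_map_eq_map` — the image of `P ∈ GL_n(R)` in `GL_n(F)` is the entrywise image;
* `exists_cartan_diagonal` — **the decomposition** for a nonsingular `g ∈ M_n(F)`;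
* `exists_cartan_diagonal_units` — the same for `g ∈ GL_n(F)` with `k₁, k₂` in the subgroup
  `(GeneralLinearGroup.map (algebraMap R F)).range` (the `K` every Hecke file of this seat takes).

Hypotheses as stated in the kernel: `R` a commutative domain with `IsPrincipalIdealRing R`;
`F` a field with `[Algebra R F] [IsFractionRing R F]`; `ι` a finite type with decidable equality.
-/

namespace Summit.Ventures.HodgeRepro2.T5SmithFractionField

open Matrix

variable {R : Type*} [CommRing R]
variable {F : Type*} [Field F] [Algebra R F]
variable {ι : Type*} [Fintype ι] [DecidableEq ι]

/-- If the entrywise image of an integral matrix has non-zero determinant so has the matrix. -/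
theorem det_ne_zero_of_det_map_ne_zero (g₀ : Matrix ι ι R)
    (h : (g₀.map (algebraMap R F)).det ≠ 0) : g₀.det ≠ 0 := by
  intro h0
  apply h
  rw [← RingHom.mapMatrix_apply, ← RingHom.map_det, h0, map_zero]

/-- The matrix underlying the image of `P ∈ GL ι R` in `GL ι F` is the entrywise image. -/
theorem coe_map_eq_map (P : GL ι R) :
    ((Matrix.GeneralLinearGroup.map (algebraMap R F) P : GL ι F) : Matrix ι ι F) =
      (P : Matrix ι ι R).map (algebraMap R F) := by
  ext i j
  rw [Matrix.GeneralLinearGroup.map_apply, Matrix.map_apply]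

variable [IsDomain R] [IsFractionRing R F]

omit [DecidableEq ι] in
/-- Clearing denominators: every matrix over the fraction field is, up to a non-zero scalar
`d ∈ R`, the image of an integral matrix. -/
theorem exists_integer_matrix (g : Matrix ι ι F) :
    ∃ (d : R) (g₀ : Matrix ι ι R), d ≠ 0 ∧ g₀.map (algebraMap R F) = algebraMap R F d • g := by
  obtain ⟨b, hb⟩ := IsLocalization.exist_integer_multiples (nonZeroDivisors R)
    (Finset.univ : Finset (ι × ι)) (fun p => g p.1 p.2)
  have hb' : ∀ p : ι × ι, ∃ r : R, algebraMap R F r = (b : R) • g p.1 p.2 :=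
    fun p => RingHom.mem_rangeS.mp (hb p (Finset.mem_univ p))
  choose r hr using hb'
  refine ⟨b, Matrix.of fun i j => r (i, j), nonZeroDivisors.coe_ne_zero b, ?_⟩
  ext i j
  rw [Matrix.map_apply, Matrix.of_apply, hr, Matrix.smul_apply, Algebra.smul_def, smul_eq_mul]

omit [IsDomain R] in
/-- The entrywise image of a nonsingular integral matrix is nonsingular (the map
`R → F` is injective). -/
theorem det_map_ne_zero_of_det_ne_zero (g₀ : Matrix ι ι R) (h : g₀.det ≠ 0) :
    (g₀.map (algebraMap R F)).det ≠ 0 := by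
  rw [← RingHom.mapMatrix_apply, ← RingHom.map_det]
  exact (map_ne_zero_iff _ (IsFractionRing.injective R F)).mpr h

variable [IsPrincipalIdealRing R]

/-- **The Cartan decomposition** for a nonsingular matrix over the fraction field of a PID:
`g = P · diagonal a · Q` with `P, Q` the images of elements of `GL ι R` and all `a i ≠ 0`. -/
theorem exists_cartan_diagonal (g : Matrix ι ι F) (hg : g.det ≠ 0) :
    ∃ (P Q : GL ι R) (a : ι → F), (∀ i, a i ≠ 0) ∧
      g = ((Matrix.GeneralLinearGroup.map (algebraMap R F) P : GL ι F) : Matrix ι ι F) *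
        diagonal a *
        ((Matrix.GeneralLinearGroup.map (algebraMap R F) Q : GL ι F) : Matrix ι ι F) := by
  obtain ⟨d, g₀, hd, hg₀⟩ := exists_integer_matrix (R := R) g
  have hdF : algebraMap R F d ≠ 0 := (map_ne_zero_iff _ (IsFractionRing.injective R F)).mpr hd
  have hdet₀ : g₀.det ≠ 0 := by
    apply det_ne_zero_of_det_map_ne_zero (F := F)
    rw [hg₀, Matrix.det_smul]
    exact mul_ne_zero (pow_ne_zero _ hdF) hg
  obtain ⟨P, Q, a, ha, hfac⟩ := T5SmithNonsingular.exists_smith_units g₀ hdet₀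
  refine ⟨P, Q, fun i => (algebraMap R F d)⁻¹ * algebraMap R F (a i), ?_, ?_⟩
  · intro i
    exact mul_ne_zero (inv_ne_zero hdF)
      ((map_ne_zero_iff _ (IsFractionRing.injective R F)).mpr (ha i))
  · have h1 : g = (algebraMap R F d)⁻¹ • g₀.map (algebraMap R F) := by
      rw [hg₀, smul_smul, inv_mul_cancel₀ hdF, one_smul]
    rw [h1, hfac, Matrix.map_mul, Matrix.map_mul, Matrix.diagonal_map (map_zero _),
      coe_map_eq_map, coe_map_eq_map, ← Matrix.smul_mul, ← Matrix.mul_smul, ← Matrix.diagonal_smul]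
    rfl

/-- **The Cartan decomposition** `GL_n(F) = K · A · K` with `K = GL_n(R)`: every `g ∈ GL ι F` is
`k₁ · diagonal a · k₂` with `k₁, k₂ ∈ (GeneralLinearGroup.map (algebraMap R F)).range` and all
`a i ≠ 0`. -/
theorem exists_cartan_diagonal_units (g : GL ι F) :
    ∃ k₁ ∈ (Matrix.GeneralLinearGroup.map (n := ι) (algebraMap R F)).range,
      ∃ k₂ ∈ (Matrix.GeneralLinearGroup.map (n := ι) (algebraMap R F)).range,
        ∃ a : ι → F, (∀ i, a i ≠ 0) ∧
          (g : Matrix ι ι F) = (k₁ : Matrix ι ι F) * diagonal a * (k₂ : Matrix ι ι F) := by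
  have hg : (g : Matrix ι ι F).det ≠ 0 := by
    have := (Matrix.isUnit_iff_isUnit_det (g : Matrix ι ι F)).mp g.isUnit
    exact isUnit_iff_ne_zero.mp this
  obtain ⟨P, Q, a, ha, hfac⟩ := exists_cartan_diagonal (R := R) (g : Matrix ι ι F) hg
  exact ⟨Matrix.GeneralLinearGroup.map (algebraMap R F) P, ⟨P, rfl⟩,
    Matrix.GeneralLinearGroup.map (algebraMap R F) Q, ⟨Q, rfl⟩, a, ha, hfac⟩

end Summit.Ventures.HodgeRepro2.T5SmithFractionField
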